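import Summits.RiemannHypothesis.RiemannHypothesis.Theorems.TiltedLandingLaw421R3PerturbativeRung2

/-!
# RUNG-P's remaining socket `NearMassMonotonePairQ μ₀` — the EXACT three-regime split (C1 g36, W-08; director (CA790)(A))

After LAND #1224 (`RhW08.BudgetTable.k2`), `RhW08.PerturbativeRung2.rungP_of_pair_instance` needs exactly ONE typed-open hypothesis,
`NearMassMonotonePairQ (1/2)` (#1190): every charged β-level `(v, z)` above the floor at `v` that is NOT (pair-light within `μ₀` ∧ above the floor at `z`)
has `X ≥ 5/2`.  Its antecedent `¬ (LightPairAt μ₀ f j v z ∧ 30 ≤ λ_z)` is a union of three geometrically different regimes; this file TYPES them as three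
sockets and proves the split is EXACT (an `Iff`, pure logic — no analysis is moved or hidden):
* `HeavySubfloorZQ`      — SUBFLOOR AT `z`: `λ_z < 30` (the upper zero sits in a weak field; `μ₀`-free);
* `HeavyNearCoincidentQ` — NEAR-COINCIDENT pair: both floors, `2‖v − z‖ < Im v` (the two zeros merge at pair scale; `μ₀`-free);
* `HeavyMassQ μ₀`        — MASS: both floors, separated (`Im v ≤ 2‖v − z‖`), and NO common light witness with hull within `μ₀` (`¬ LightPairAt μ₀`) —
  the only `μ₀`-dependent piece, and it gets WEAKER (easier) as `μ₀` grows (`heavyMassQ_mono`), opposite to K-2's light side (landed at `μ₀ = 1/2` only).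
`nearMassMonotonePairQ_iff_split : NearMassMonotonePairQ μ₀ ↔ HeavySubfloorZQ ∧ HeavyNearCoincidentQ ∧ HeavyMassQ μ₀`, and the instance reading
`rungP_of_three (h₁ h₂ h₃) : RungP` at `μ₀ = 1/2` over the TREE theorem `RhW08.BudgetTable.k2` is NOT stated here (this file imports #1190 only, not #1224),
see `rungP_of_split`.  Purpose: instr-1's falsifier column F-b and C2's pricing can now be run PER REGIME, and a K-level attack can take the pieces one at a time.
All three sockets are UNPROVED and substantive.  Nothing here bears on the truth of RH; RH is not proved; RUNG-P / 33346 / 33347 OPEN; typed ≠ proved.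
-/

namespace RhW08.HeavyPairSplit

open Complex RhW08.Round1 RhW08.StSwap RhW08.Round2 RhW08.QuadW RhW08.SealSwapQ RhW08.RateSplit RhW08.BurgersRate RhW08.BurgersRateG3
open RhW08.SealSwap (PBot)
open RhW08.TouchedDissipation RhW08.PerturbativeRung RhW08.PerturbativeRung2
open RhW08.AntiEscapeSplit7 RhIdea6.G17.W07C7 RhIdea6.G17.W07C7.Rev6 RhIdea6.G18.W07C8.Law421BirthS RhIdea6.G19.W07C11.Seam RhIdea6.G20.W07C12.Frac
open RhIdea6.G20.W07C12.StColP RhW07.C12.FieldSplit RhIdea6.G21.W07C13.TentMax RhW07.C14.TwoSided RhW07.C14.Classes RhW07.C14.Lineage RhW07.C14.Booking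

/-- ★ regime 1 (UNPROVED, substantive; `μ₀`-free) SUBFLOOR AT `z`: a charged β-level above the floor at `v` whose upper zero `z` is below the floor
(`λ_z = Im z·κ_z < 30`) has `X ≥ 5/2`. -/
def HeavySubfloorZQ : Prop :=
  ∀ (η : ℝ) (f : ℂ → ℂ) (x₀ s hmax R Hs : ℝ) (B : ℕ), EngineHyps5 2 η f x₀ s hmax R Hs B → ∀ (j : ℕ) (v z : ℂ), BetaLevel η f x₀ s hmax R Hs B j v z →
    30 ≤ v.im * stateKappa f j v → z.im * stateKappa f j z < 30 →
      5 / 2 ≤ ((v.im ^ 2 + z.im ^ 2) - childEnergy f j (pairUnion v z)) * stateKappa f j v ^ 2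

/-- ★ regime 2 (UNPROVED, substantive; `μ₀`-free) NEAR-COINCIDENT PAIR: both floors hold and the natural-unit separation FAILS, `2‖v − z‖ < Im v`
(the two zeros are closer than half the height of the lower one); then `X ≥ 5/2`. -/
def HeavyNearCoincidentQ : Prop :=
  ∀ (η : ℝ) (f : ℂ → ℂ) (x₀ s hmax R Hs : ℝ) (B : ℕ), EngineHyps5 2 η f x₀ s hmax R Hs B → ∀ (j : ℕ) (v z : ℂ), BetaLevel η f x₀ s hmax R Hs B j v z →
    30 ≤ v.im * stateKappa f j v → 30 ≤ z.im * stateKappa f j z → 2 * ‖v - z‖ < v.im →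
      5 / 2 ≤ ((v.im ^ 2 + z.im ^ 2) - childEnergy f j (pairUnion v z)) * stateKappa f j v ^ 2

/-- ★ regime 3 (UNPROVED, substantive) MASS: both floors hold, the pair IS separated (`Im v ≤ 2‖v − z‖`), and the pair is NOT light within `μ₀`
(no common v5 light witness `M ≤ μ₀` at `v` and `z` with the hull clause on `[v, z]`); then `X ≥ 5/2`. -/
def HeavyMassQ (μ₀ : ℝ) : Prop :=
  ∀ (η : ℝ) (f : ℂ → ℂ) (x₀ s hmax R Hs : ℝ) (B : ℕ), EngineHyps5 2 η f x₀ s hmax R Hs B → ∀ (j : ℕ) (v z : ℂ), BetaLevel η f x₀ s hmax R Hs B j v z →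
    30 ≤ v.im * stateKappa f j v → 30 ≤ z.im * stateKappa f j z → v.im ≤ 2 * ‖v - z‖ → ¬ LightPairAt μ₀ f j v z →
      5 / 2 ≤ ((v.im ^ 2 + z.im ^ 2) - childEnergy f j (pairUnion v z)) * stateKappa f j v ^ 2

/-- a light pair is separated (the separation clause of `LightPairAt`). -/
theorem sep_of_lightPairAt {μ₀ : ℝ} {f : ℂ → ℂ} {j : ℕ} {v z : ℂ} (h : LightPairAt μ₀ f j v z) : v.im ≤ 2 * ‖v - z‖ := by
  obtain ⟨M, -, -, -, hsep, -⟩ := h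
  exact hsep

/-- `LightPairAt` is monotone in the mass allowance `μ₀`. -/
theorem lightPairAt_mono {μ₀ μ₁ : ℝ} (hμ : μ₀ ≤ μ₁) {f : ℂ → ℂ} {j : ℕ} {v z : ℂ} (h : LightPairAt μ₀ f j v z) :
    LightPairAt μ₁ f j v z := by
  obtain ⟨M, hM, hv, hz, hsep, hg⟩ := h
  exact ⟨M, hM.trans hμ, hv, hz, hsep, hg⟩

/-- the MASS socket gets weaker as `μ₀` grows (fewer pairs are heavy). -/
theorem heavyMassQ_mono {μ₀ μ₁ : ℝ} (hμ : μ₀ ≤ μ₁) (h : HeavyMassQ μ₀) : HeavyMassQ μ₁ := by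
  intro η f x₀ s hmax R Hs B hE j v z hβ hfl hz hsep hnl
  exact h η f x₀ s hmax R Hs B hE j v z hβ hfl hz hsep (fun hL => hnl (lightPairAt_mono hμ hL))

/-- ASSEMBLY (pure logic): the three regimes give the pair-heavy monotonicity socket. -/
theorem nearMassMonotonePairQ_of_split {μ₀ : ℝ} (h₁ : HeavySubfloorZQ) (h₂ : HeavyNearCoincidentQ) (h₃ : HeavyMassQ μ₀) :
    NearMassMonotonePairQ μ₀ := by
  intro η f x₀ s hmax R Hs B hE j v z hβ hfl hnot
  by_cases hz : 30 ≤ z.im * stateKappa f j z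
  · by_cases hsep : v.im ≤ 2 * ‖v - z‖
    · exact h₃ η f x₀ s hmax R Hs B hE j v z hβ hfl hz hsep (fun hL => hnot ⟨hL, hz⟩)
    · exact h₂ η f x₀ s hmax R Hs B hE j v z hβ hfl hz (lt_of_not_ge hsep)
  · exact h₁ η f x₀ s hmax R Hs B hE j v z hβ hfl (lt_of_not_ge hz)

/-- CONVERSELY each regime is a restriction of the socket: the split is EXACT (nothing is lost or added). -/
theorem split_of_nearMassMonotonePairQ {μ₀ : ℝ} (h : NearMassMonotonePairQ μ₀) :
    HeavySubfloorZQ ∧ HeavyNearCoincidentQ ∧ HeavyMassQ μ₀ := by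
  refine ⟨?_, ?_, ?_⟩
  · intro η f x₀ s hmax R Hs B hE j v z hβ hfl hz
    exact h η f x₀ s hmax R Hs B hE j v z hβ hfl (fun hc => absurd hc.2 (not_le.mpr hz))
  · intro η f x₀ s hmax R Hs B hE j v z hβ hfl _ hnc
    exact h η f x₀ s hmax R Hs B hE j v z hβ hfl (fun hc => absurd (sep_of_lightPairAt hc.1) (not_le.mpr hnc))
  · intro η f x₀ s hmax R Hs B hE j v z hβ hfl _ _ hnl
    exact h η f x₀ s hmax R Hs B hE j v z hβ hfl (fun hc => hnl hc.1)

/-- ★ the split is an equivalence. -/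
theorem nearMassMonotonePairQ_iff_split {μ₀ : ℝ} :
    NearMassMonotonePairQ μ₀ ↔ HeavySubfloorZQ ∧ HeavyNearCoincidentQ ∧ HeavyMassQ μ₀ :=
  ⟨split_of_nearMassMonotonePairQ, fun h => nearMassMonotonePairQ_of_split h.1 h.2.1 h.2.2⟩

/-- RUNG-P from the light-pair drop and the THREE heavy regimes (instance `(C, μ₀) = (10, 1/2)`; with TREE #1224 `RhW08.BudgetTable.k2` for `hL`,
RUNG-P rests on `HeavySubfloorZQ`, `HeavyNearCoincidentQ`, `HeavyMassQ (1/2)` alone). -/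
theorem rungP_of_split (hL : PerturbativeDropLightPairQ 10 (1 / 2))
    (h₁ : HeavySubfloorZQ) (h₂ : HeavyNearCoincidentQ) (h₃ : HeavyMassQ (1 / 2)) : RungP :=
  rungP_of_pair_instance hL (nearMassMonotonePairQ_of_split h₁ h₂ h₃)

end RhW08.HeavyPairSplit
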